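import Summits.BirchSwinnertonDyer.BirchSwinnertonDyer.Theses.GenusKolyvaginAtTwo
import Summits.BirchSwinnertonDyer.BirchSwinnertonDyer.Theorems.GenusKolyvaginAtTwoMinimalTwinBSDTwoUniformCell
import HarnessLib

/-!
# LINE 23 «twin_swap» v2.3 «UNIFORM» (ONE research stub: the 2-primary Gross–Zagier index relation KEX; no trichotomy, no per-locus exponent,
# no declared residual locus) on crux hTw `MinimalTwinBSDTwo` (stmt-BirchSwinnertonDyer-22985, route `GenusKolyvaginAtTwo` rev 59)

Seat `bsd-line-gk2-p2` g27 (PROVER 2/3, cell bsd-f1-sign2, LINE 23 holder), 2026-08-30, on top of v2.1 (g26) and of gk2-p3 g33's v2.2 turnkey (`Lines/twin_swap_v22_gk2p3.lean` = v2.1 with KEX_id ↦ EXP_id).  Nothing here proves BSD, U₂, the wall,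
the converses or KEX.

WHAT CHANGED vs v2.1 / v2.2.  v2.1 (and v2.2, which only re-shapes the identity-locus stub as «2^{ord₂ c + ord₂ C(W) + 1} ∥ P(1)») proved hTw by the exhaustive trichotomy `Δ < 0` ∨ (`Δ > 0 ∧ MeetsEgg`) ∨ (`Δ > 0 ∧ ¬MeetsEgg`), one research stub per
class (EXP⁻_all, EXP⁺_all, KEX_id), each engine re-deriving its own twin supply.  g26's last two landings make this unnecessary: THE TWIN EXISTS
(`IdentityDoor.exists_primeHeegner_selmerTrivial_minimalTwin_of_rank_one`, p782923, UNCONDITIONAL — the trichotomy is INSIDE it) and the sign-free,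
budget-free sha-depth descent (`IdentityDoor.swappedPairDescentAtTwo_shaDepth_of_facts`, p778694).  So (this seat, `…Theorems.GenusKolyvaginAtTwoMinimalTwinBSDTwoUniformCell`,
`Uniform.bsdp_of_wall_of_converse_of_kex_of_facts`): **hTw ⟸ WALL row 1 + CONV₀ (19218 + 19219 + off-semistable residual) + KEX + PRINT×5** — FIVE
stubs; the only research stub KEX (`HeegnerIndexRelationAtTwo` below) is ONE ∀-statement with no sign / egg / image / Tamagawa case, and it is
LOSSLESS: U₂ + S1 + PRINT ⟹ KEX (`Uniform.kexAll_of_minimalTwinBSDTwo_of_wall_of_facts`).  The v2.1 / v2.2 exponent stubs are its DICTIONARY on their door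
classes (`Uniform.twoDepth_eq_of_kex_of_le_succ` / `…_silent` / `…_eq_succ_of_kex_identity`: `M₀ = ord₂ c + ord₂ C(W)` on one-bit and silent frames,
`+ 1` at identity primes — gk2-p3 g33's `#Ш(W_K)[2^∞] = 4`).  `MinimalTwinBSDTwo_of : …Theses.GenusKolyvaginAtTwo.MinimalTwinBSDTwo` has no
hypothesis.  BSD is NOT proved by any of this.
-/

set_option linter.dupNamespace false -- `Summit.<P>.<Sub>` repeats `BirchSwinnertonDyer` (D-0017)

namespace Summit.BirchSwinnertonDyer.BirchSwinnertonDyer.Cruxes.MinimalTwinBSDTwo.TwinSwapV23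

open scoped Classical NumberField

open Summit.BirchSwinnertonDyer.BirchSwinnertonDyer.Theses.GenusKolyvaginAtTwo
open WeierstrassCurve NumberField Literature.NumberTheory.EllipticCurves Literature.NumberTheory.EllipticCurves.ModularForms
open Summit.BirchSwinnertonDyer.BirchSwinnertonDyer.Theorems
open Summit.BirchSwinnertonDyer.BirchSwinnertonDyer.Theorems.GenusExact.TwinSwap.Ledger.Line25 (rankZeroTwoConverse_of_items_of_offSemistable)
open Summit.BirchSwinnertonDyer.BirchSwinnertonDyer.Theorems.GenusExact.TwinSwap.Uniform (bsdp_of_wall_of_converse_of_kex_of_facts)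
open Literature.NumberTheory.EllipticCurves.Rank1Residual (GoodOrd Mult)
open Summit.BirchSwinnertonDyer.BirchSwinnertonDyer.Theses.TwoAdicConverse (GoodOrdinaryRankZeroTwoConverse MultiplicativeRankZeroTwoConverse)
open Summit.BirchSwinnertonDyer.BirchSwinnertonDyer.Theses.ByReductionTypeAtTwo
  (GoodOrdinaryRankZeroAtTwo MultiplicativeRankZeroAtTwo SupersingularRankZeroAtTwo AdditiveRankZeroAtTwo)

/-! ## The displayed Props (S1 and the CONV₀ residual VERBATIM from v1.1–v2.1; KEX = the ONE research statement) -/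

/-- S1 · the swapped ANCHOR (verbatim v1.1–v2.1): BSD₂ for non-CM curves of analytic rank 0 with trivial 2-Selmer group. -/
def MinimalRankZeroBSDTwo : Prop :=
  ∀ (W : WeierstrassCurve ℚ) [W.IsElliptic] [W.IsGloballyMinimal],
    ¬ W.HasCM → W.analyticRank = 0 → Nat.card (W.selmerGroup 2) = 1 →
      Literature.NumberTheory.EllipticCurves.BSDp W 2

/-- KEX · THE 2-PRIMARY GROSS–ZAGIER INDEX RELATION FOR THE RANK-ONE MEMBER (the ONE research statement of v2.3; = Gross's conjecture
(Gross–Zagier V (2.2) ⊗ BSD) at `p = 2` on the swapped frames; the currency of the route's rank-zero exactness items Q3R_T / Q4_T): for `W` non-CM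
globally minimal with `r_an = 1`, `#Sel₂(W) = 2`, at EVERY imaginary quadratic `K = ℚ(√−ℓ)` (`ℓ` prime, `d_K` odd `≠ −3`, Heegner for `N_W`, `2` split),
EVERY globally minimal `Wd ≅ W^{(d_K)}` with `#Sel₂(Wd) = 1`, `L(W^{(d_K)},1) ≠ 0`, and EVERY conductor-`1` datum: SOME exact depth `2^{M₀} ∥ P(1)` has
**`#Ш(W_K)[2^∞] · 4^{ord₂ c + ord₂ C(W)} = 4^{M₀}`**.  LOSSLESS (U₂ + S1 + PRINT ⟹ KEX, `Uniform.kexAll_of_minimalTwinBSDTwo_of_wall_of_facts`);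
DICTIONARY: `M₀ = ord₂ c + ord₂ C(W)` on one-bit (`Δ < 0`) and silent frames, `+ 1` at identity primes (`Uniform.twoDepth_eq_…`). -/
def HeegnerIndexRelationAtTwo : Prop :=
  ∀ (W : WeierstrassCurve ℚ) [W.IsElliptic] [W.IsGloballyMinimal] [NeZero (W.conductorNorm ℤ)],
    ¬ W.HasCM → W.analyticRank = 1 → Nat.card (W.selmerGroup 2) = 2 →
    ∀ (K : Type) [Field K] [NumberField K], IsImaginaryQuadratic K →
      ∀ (ℓ : ℕ), ℓ.Prime → NumberField.discr K = -(ℓ : ℤ) →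
      Odd (NumberField.discr K) → NumberField.discr K ≠ -3 → SatisfiesHeegnerHypothesis (W.conductorNorm ℤ) K →
      ((Ideal.span {(2 : ℤ)}).primesOver (𝓞 K)).ncard = 2 →
      ∀ (Wd : WeierstrassCurve ℚ) [Wd.IsElliptic] [Wd.IsGloballyMinimal],
        (∃ C : VariableChange ℚ, C • W.quadraticTwist (NumberField.discr K : ℚ) = Wd) → Nat.card (Wd.selmerGroup 2) = 1 →
      (W.quadraticTwist (NumberField.discr K : ℚ)).entireLFunction 1 ≠ 0 →
      ∀ (Dt : ModularParametrizationData W (W.conductorNorm ℤ)) (β : ℤ) (ι : K →+* ℂ) (d₁ : KolyvaginHeegnerData Dt β ι 1),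
        ∃ M₀ : ℕ,
          (∃ Q : (W.baseChange (ringClassField K ι 1)).toAffine.Point, ((2 ^ M₀ : ℕ) : ℤ) • Q = d₁.derivedPoint) ∧
          (¬ ∃ Q : (W.baseChange (ringClassField K ι 1)).toAffine.Point, ((2 ^ (M₀ + 1) : ℕ) : ℤ) • Q = d₁.derivedPoint) ∧
          Nat.card (AddCommGroup.primaryComponent (W.baseChange K).sha 2) *
              2 ^ (2 * (padicValInt 2 Dt.c + padicValNat 2 W.tamagawaProduct)) = 2 ^ (2 * M₀)

/-- CONV₀-residual · declared RESIDUAL (verbatim v1.7–v2.1, gk2-p3 g30's text): the rank-zero `2`-converse OFF the semistable-ordinary locus at `2`. -/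
def RankZeroTwoConverseOffSemistableAtTwo : Prop :=
  ∀ (V : WeierstrassCurve ℚ) [V.IsElliptic] [V.IsGloballyMinimal], ¬ V.HasCM → ¬ (GoodOrd V 2 ∨ Mult V 2) →
    V.selmerCorank 2 = 0 → V.analyticRank = 0

/-! ## The five stubs (WALL row 1 ×4 bundled · CONV₀ items ×2 bundled · CONV₀ off-semistable residual · KEX · PRINT ×5 bundled) -/

/-- stub WALL = items `GoodOrdinaryRankZeroAtTwo` (stmt-BirchSwinnertonDyer-19095), `MultiplicativeRankZeroAtTwo`, `SupersingularRankZeroAtTwo`,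
`AdditiveRankZeroAtTwo` (route ByReductionTypeAtTwo, WALL row 1) BY NAME — the anchor. -/
theorem stub_wallRankZeroAtTwo :
    GoodOrdinaryRankZeroAtTwo ∧ MultiplicativeRankZeroAtTwo ∧ SupersingularRankZeroAtTwo ∧ AdditiveRankZeroAtTwo := by
  sorry

/-- stub CONV₀ = items stmt-BirchSwinnertonDyer-19218 `GoodOrdinaryRankZeroTwoConverse` and stmt-19219 `MultiplicativeRankZeroTwoConverse` (route
TwoAdicConverse) BY NAME. -/
theorem stub_rankZeroTwoConverseItems : GoodOrdinaryRankZeroTwoConverse ∧ MultiplicativeRankZeroTwoConverse := by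
  sorry

/-- stub CONV₀-residual (DECLARED residual: rank-zero `2`-converse off the semistable-ordinary locus at `2`; nobody's item). -/
theorem stub_rankZeroTwoConverseOffSemistable : RankZeroTwoConverseOffSemistableAtTwo := by
  sorry

/-- stub KEX — the 2-primary Gross–Zagier index relation for the rank-one member (research content = BSD₂ there mod the rest, LOSSLESS). -/
theorem stub_heegnerIndexRelation : HeegnerIndexRelationAtTwo := by
  sorry

/-- stub PRINT = the route's four print items BY NAME — `GrossZagierAllLevels` (24148), `MultPublishedInputsAtTwo` (19921 = GZK), `EntireLFunctionRat` (19273),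
`MilneAnyModel` (24149) — and the modular parametrisation existence `nonempty_modularParametrizationData` (BCDT 2001 Thm. A; Literature statement-only fact). -/
theorem stub_printFacts :
    GrossZagierAllLevels ∧ MultPublishedInputsAtTwo ∧ EntireLFunctionRat ∧ MilneAnyModel ∧ nonempty_modularParametrizationData := by
  sorry

/-! ## The closed piece: the S1 door -/

/-- P1 door (critic #414, verbatim v1.1): WALL row 1 (ByReductionTypeAtTwo 19095–19098) ⟹ S1, by the reduction-type tetrachotomy at `2`. -/
theorem minimalRankZeroBSDTwo_of_wall (hOrd : GoodOrdinaryRankZeroAtTwo) (hMult : MultiplicativeRankZeroAtTwo)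
    (hSS : SupersingularRankZeroAtTwo) (hAdd : AdditiveRankZeroAtTwo) : MinimalRankZeroBSDTwo := by
  intro W _ _ hCM hr _hSel
  by_cases hg : W.HasGoodReductionAtPrime 2
  · by_cases hd : ((2 : ℕ) : ℤ) ∣ W.frobeniusTrace 2
    · exact hSS W hCM hr ⟨hg, hd⟩
    · exact hOrd W hCM hr ⟨hg, hd⟩
  · by_cases hm : W.HasMultiplicativeReductionAtPrime 2
    · exact hMult W hCM hr hm
    · exact hAdd W hCM hr ⟨hg, hm⟩

/-! ## The composition -/

/-- COMPOSITION v2.3 with displayed inputs (kernel-checked, no sorry of its own): S1 + CONV₀ (19218, 19219, off-semistable residual) + KEX + PRINT×5 prove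
hTw BY NAME — ONE cell: the rank-zero `2`-converse from the three pieces (p775371 `rankZeroTwoConverse_of_items_of_offSemistable`), then
`Uniform.bsdp_of_wall_of_converse_of_kex_of_facts` (twin existence + converse + datum + Gross–Zagier + KEX + wall + sha-depth descent).  No trichotomy,
no residual locus. -/
theorem minimalTwinBSDTwo_of_inputs (h1 : MinimalRankZeroBSDTwo) (hC0g : GoodOrdinaryRankZeroTwoConverse)
    (hC0m : MultiplicativeRankZeroTwoConverse) (hC0r : RankZeroTwoConverseOffSemistableAtTwo) (hKEX : HeegnerIndexRelationAtTwo)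
    (hGZ : GrossZagierAllLevels) (hGZK : MultPublishedInputsAtTwo) (hL : EntireLFunctionRat) (hMi : MilneAnyModel)
    (hMP : nonempty_modularParametrizationData) :
    -- (= `MinimalTwinBSDTwo` unfolded, so that `MinimalTwinBSDTwo_of` below is the FIRST theorem concluding the crux decl by name)
    ∀ (W : WeierstrassCurve ℚ) [W.IsElliptic] [W.IsGloballyMinimal],
      ¬ W.HasCM → W.analyticRank = 1 → Nat.card (W.selmerGroup 2) = 2 → Literature.NumberTheory.EllipticCurves.BSDp W 2 :=
  bsdp_of_wall_of_converse_of_kex_of_facts hGZ hGZK hL hMi hMP h1 (rankZeroTwoConverse_of_items_of_offSemistable hC0g hC0m hC0r) hKEX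

/-- **THE LINE CONCLUDES THE CRUX BY NAME**: `MinimalTwinBSDTwo` (stmt-BirchSwinnertonDyer-22985) from the five stubs — WALL row 1 (items, bundled), CONV₀
(items 19218 ∧ 19219, bundled), CONV₀ off-semistable residual, KEX, PRINT×5 (bundled).  Sorry-free outside the stubs; no residual locus. -/
theorem MinimalTwinBSDTwo_of : Summit.BirchSwinnertonDyer.BirchSwinnertonDyer.Theses.GenusKolyvaginAtTwo.MinimalTwinBSDTwo :=
  minimalTwinBSDTwo_of_inputs
    (minimalRankZeroBSDTwo_of_wall stub_wallRankZeroAtTwo.1 stub_wallRankZeroAtTwo.2.1 stub_wallRankZeroAtTwo.2.2.1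
      stub_wallRankZeroAtTwo.2.2.2)
    stub_rankZeroTwoConverseItems.1 stub_rankZeroTwoConverseItems.2 stub_rankZeroTwoConverseOffSemistable stub_heegnerIndexRelation
    stub_printFacts.1 stub_printFacts.2.1 stub_printFacts.2.2.1 stub_printFacts.2.2.2.1 stub_printFacts.2.2.2.2

end Summit.BirchSwinnertonDyer.BirchSwinnertonDyer.Cruxes.MinimalTwinBSDTwo.TwinSwapV23
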